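import Mathlib
import Summits.NavierStokesRegularity.NavierStokesRegularity.Theorems.FilamentSkeletonRssStadiumRightWingGeneral

/-!
# Route `FilamentSkeletonRss` · cruxes `SkeletonJ1L` (stmt-NavierStokesRegularity-23296, registered stub `stub_tangentSkeletonL` ≡
# `TangentSkeletonNearStraightL`, stmt-23320) · line `child_tangent_analytic_strip_L` (b0b56c52900dd90a), stub `stub_stripPropagation` —
# brick for the BOUND clause of `rcore`: QUANTITATIVE MARGINS ALONG THE DESCENTS OF THE SYMMETRIC QUARTER-WIDTH TENT, EVERY ANCHOR

The wing certificates were landed as POSITIVITY (`Theorems.StadiumRightWingPos` … `RightWingGeneral`, `Theorems.StadiumLeftWingPos`), which is what the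
freeze needs; the explicit BOUND of `rcore` needs a MARGIN.  The middle and far descent pieces carry one (`corner_right_descent_mid_re_ge` `(0.06hs)²`,
`corner_right_descent_far_re_ge` `(0.007hs)²`); here the near piece gets one (`near_descent_re_ge`, `(0.04hs)²`, from the second-order sloped-chord estimate
`Theorems.StadiumDescentShortChord.descent_chord_sq_sub_sq_le` and the slack in the near polynomial inequality), the three are glued in segment form
(`right_descent_re_ge`, `(0.007hs)² ≤ Re Σᵢ (Fᵢ z₀ − Fᵢ ζ)²` along the descent of a corner-normalised anchor above the axis) and transported exactly as
the positivity was: below the axis by conjugation (`right_descent_re_ge_any`, `Theorems.StadiumCornerConj.chord_sq_conj`), to every anchor of the quarter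
stadium by re-centring (`right_descent_re_ge_general`, `Theorems.StadiumCornerTransport`), and to the LEFT ascent by point reflection
(`left_ascent_re_ge_general`, tent orientation).  With `Theorems.StadiumQuarterPlateauBound.quarter_plateau_re_ge` every complex source of the symmetric
tent now has an explicit margin.
HONEST FRAMING: a brick for the bookkeeping of a HYPOTHETICAL filament skeleton on the NEGATIVE side of a MODEL route; the stub `stub_stripPropagation`
is NOT closed by this file, `TangentSkeletonNearStraightL` / `SkeletonJ1L` stay OPEN; nothing here bears on Navier–Stokes regularity or blow-up.
`--supports stmt-NavierStokesRegularity-23320` (≡ stub `stub_tangentSkeletonL` of 23296).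
-/

set_option linter.dupNamespace false

noncomputable section

namespace Summit.NavierStokesRegularity.NavierStokesRegularity.Theorems.StadiumQuarterDescentMargin

open Set Complex
open scoped InnerProductSpace ComplexConjugate
open Summit.NavierStokesRegularity.NavierStokesRegularity.Theorems.StadiumDescentShortChord
open Summit.NavierStokesRegularity.NavierStokesRegularity.Theorems.StadiumCornerRightNear
open Summit.NavierStokesRegularity.NavierStokesRegularity.Theorems.StadiumCornerQuantVariance
open Summit.NavierStokesRegularity.NavierStokesRegularity.Theorems.StadiumCornerQuantFeet
open Summit.NavierStokesRegularity.NavierStokesRegularity.Theorems.StadiumCornerConj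
open Summit.NavierStokesRegularity.NavierStokesRegularity.Theorems.StadiumCornerTransport
open Summit.NavierStokesRegularity.NavierStokesRegularity.Theorems.StadiumDeviationReflect

/-- **Near descent, quantitative (`f ≤ 2/5`).**  Stadium `S`, `F` holomorphic with `‖F′‖ ≤ 2`, `Σ (F′)ᵢ² = 1`; target `z = x₀ + iY` with
`0 ≤ Y < hs/4`, `cc ≤ x₀ < cc + L + hs/4`; descent source `ζ(f) = (x₀ + hs/5 + (3hs/10)f) + iY(1−f)`, `0 ≤ f ≤ 2/5`:
`(0.04·hs)² ≤ Re Σᵢ (Fᵢ(ζ) − Fᵢ(z))²`. [folklore] -/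
theorem near_descent_re_ge {hs L cc : ℝ} {F : ℂ → (Fin 3 → ℂ)}
    (hF : DifferentiableOn ℂ F {z : ℂ | |z.im| < hs ∧ |z.re - cc| < L + hs})
    (hM : ∀ z ∈ {z : ℂ | |z.im| < hs ∧ |z.re - cc| < L + hs}, ‖deriv F z‖ ≤ 2)
    (hunit : ∀ w ∈ {z : ℂ | |z.im| < hs ∧ |z.re - cc| < L + hs}, ∑ i, (deriv F w i) ^ 2 = 1)
    (hhs : 0 < hs) {x₀ Y f : ℝ} (hY0 : 0 ≤ Y) (hY : Y < hs / 4) (hx₀ : x₀ < cc + L + hs / 4) (hx₀cc : cc ≤ x₀)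
    (hf0 : 0 ≤ f) (hf : f ≤ 2 / 5) :
    (0.04 * hs) ^ 2 ≤ (∑ i, (F (((x₀ + (hs / 5 + 3 * hs / 10 * f) : ℝ) : ℂ) + ((Y * (1 - f) : ℝ) : ℂ) * Complex.I) i -
        F ((x₀ : ℂ) + (Y : ℂ) * Complex.I) i) ^ 2).re := by
  set z : ℂ := (x₀ : ℂ) + (Y : ℂ) * Complex.I with hz
  set s : ℂ := ((hs / 5 + 3 * hs / 10 * f : ℝ) : ℂ) - ((Y * f : ℝ) : ℂ) * Complex.I with hsdef
  have ezs : ((x₀ + (hs / 5 + 3 * hs / 10 * f) : ℝ) : ℂ) + ((Y * (1 - f) : ℝ) : ℂ) * Complex.I = z + s := by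
    simp only [hz, hsdef]; push_cast; ring
  rw [ezs]
  have hsre : s.re = hs / 5 + 3 * hs / 10 * f := by simp [hsdef]
  have hsim : s.im = -(Y * f) := by simp [hsdef]
  have hzim : z.im = Y := by simp [hz]
  have hzre : z.re = x₀ := by simp [hz]
  have hzsim : (z + s).im = Y - Y * f := by rw [Complex.add_im, hzim, hsim]; ring
  have hzsre : (z + s).re = x₀ + (hs / 5 + 3 * hs / 10 * f) := by rw [Complex.add_re, hzre, hsre]
  set d : ℝ := hs * (11 / 20 - 3 / 10 * f) with hd
  have hhsf0 : 0 ≤ hs * f := mul_nonneg hhs.le hf0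
  have hhsf : hs * f ≤ hs * (2 / 5) := mul_le_mul_of_nonneg_left hf hhs.le
  have hYf0 : 0 ≤ Y * f := mul_nonneg hY0 hf0
  have hYf1 : Y * f ≤ Y := mul_le_of_le_one_right hY0 (by linarith)
  have hd' : d = hs * (11 / 20) - 3 / 10 * (hs * f) := by rw [hd]; ring
  have hdpos : 0 < d := by rw [hd']; linarith
  have hv0 : |z.im| + d < hs := by rw [hzim, abs_of_nonneg hY0, hd']; linarith
  have hv1 : |(z + s).im| + d < hs := by
    rw [hzsim, abs_of_nonneg (by linarith), hd']; linarith
  have hh0 : |z.re - cc| + d < L + hs := by rw [hzre, abs_of_nonneg (by linarith), hd']; linarith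
  have hh1 : |(z + s).re - cc| + d < L + hs := by
    have e : x₀ + (hs / 5 + 3 * hs / 10 * f) - cc = (x₀ - cc) + hs / 5 + 3 / 10 * (hs * f) := by ring
    rw [hzsre, e, abs_of_nonneg (by linarith), hd']; linarith
  have h := descent_chord_sq_sub_sq_le hF hM hunit hdpos hv0 hv1 hh0 hh1
  -- `Re Σ ≥ Re s² − (2/d)²/4 ‖s‖⁴`
  set Q : ℂ := ∑ i, (F (z + s) i - F z i) ^ 2 with hQ
  have hre : Q.re = (s ^ 2).re + (Q - s ^ 2).re := by simp [Complex.sub_re]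
  have hlow : -((2 / d) ^ 2 / 4 * ‖s‖ ^ 4) ≤ (Q - s ^ 2).re := by
    have h3 := Complex.abs_re_le_norm (Q - s ^ 2)
    have h4 := neg_abs_le (Q - s ^ 2).re
    linarith
  have hs2re : (s ^ 2).re = (hs / 5 + 3 * hs / 10 * f) ^ 2 - (Y * f) ^ 2 := by
    rw [sq, Complex.mul_re, hsre, hsim]; ring
  have hnorm : ‖s‖ ^ 2 = (hs / 5 + 3 * hs / 10 * f) ^ 2 + (Y * f) ^ 2 := by
    rw [Complex.sq_norm, Complex.normSq_apply, hsre, hsim]; ring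
  -- `‖s‖² ≤ (4/5) d²` (the near polynomial inequality) and `(Yf)² ≤ hs² f²/16`
  have hYf : (Y * f) ^ 2 ≤ hs ^ 2 * (f ^ 2 / 16) := by
    have h2 : Y * f ≤ hs / 4 * f := mul_le_mul_of_nonneg_right hY.le hf0
    have h3 : (Y * f) ^ 2 ≤ (hs / 4 * f) ^ 2 := pow_le_pow_left₀ hYf0 h2 2
    have h4 : (hs / 4 * f) ^ 2 = hs ^ 2 * (f ^ 2 / 16) := by ring
    rw [h4] at h3; exact h3
  have hpoly : (hs / 5 + 3 * hs / 10 * f) ^ 2 + (Y * f) ^ 2 ≤ (4 / 5) * d ^ 2 := by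
    have hP := near_descent_poly hf0 hf
    have hhs2 : 0 ≤ hs ^ 2 := sq_nonneg hs
    calc (hs / 5 + 3 * hs / 10 * f) ^ 2 + (Y * f) ^ 2
        ≤ (hs / 5 + 3 * hs / 10 * f) ^ 2 + hs ^ 2 * (f ^ 2 / 16) := by linarith
      _ = hs ^ 2 * ((1 / 5 + 3 / 10 * f) ^ 2 + f ^ 2 / 16) := by ring
      _ ≤ hs ^ 2 * ((4 / 5 : ℝ) * (11 / 20 - 3 / 10 * f) ^ 2) := mul_le_mul_of_nonneg_left hP hhs2
      _ = (4 / 5) * d ^ 2 := by rw [hd]; ring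
  have h4 : (2 / d) ^ 2 / 4 * ‖s‖ ^ 4 ≤ (4 / 5) * ((hs / 5 + 3 * hs / 10 * f) ^ 2 + (Y * f) ^ 2) := by
    have hd2 : 0 < d ^ 2 := by positivity
    have e : (2 / d) ^ 2 / 4 * ‖s‖ ^ 4 = (‖s‖ ^ 2 / d ^ 2) * ‖s‖ ^ 2 := by field_simp; ring
    rw [e, hnorm]
    have h5 : ((hs / 5 + 3 * hs / 10 * f) ^ 2 + (Y * f) ^ 2) / d ^ 2 ≤ 4 / 5 := by
      rw [div_le_iff₀ hd2]; linarith
    exact mul_le_mul_of_nonneg_right h5 (by positivity)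
  -- the margin polynomial on `[0, 2/5]`
  have hmain : (0.04 * hs) ^ 2 ≤ ((hs / 5 + 3 * hs / 10 * f) ^ 2 - (Y * f) ^ 2) -
      (4 / 5) * ((hs / 5 + 3 * hs / 10 * f) ^ 2 + (Y * f) ^ 2) := by
    have e : ((hs / 5 + 3 * hs / 10 * f) ^ 2 - (Y * f) ^ 2) - (4 / 5) * ((hs / 5 + 3 * hs / 10 * f) ^ 2 + (Y * f) ^ 2)
        = hs ^ 2 * ((1 / 5 + 3 / 10 * f) ^ 2 / 5) - (9 / 5) * (Y * f) ^ 2 := by ring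
    rw [e]
    have hpos : (0.0016 : ℝ) ≤ (1 / 5 + 3 / 10 * f) ^ 2 / 5 - 9 / 80 * f ^ 2 := by
      nlinarith [mul_nonneg hf0 (sub_nonneg.2 hf)]
    have hhs2 : 0 ≤ hs ^ 2 := sq_nonneg hs
    have h1 := mul_le_mul_of_nonneg_left hpos hhs2
    have e2 : (0.04 * hs) ^ 2 = hs ^ 2 * 0.0016 := by ring
    have e3 : hs ^ 2 * ((1 / 5 + 3 / 10 * f) ^ 2 / 5 - 9 / 80 * f ^ 2) =
        hs ^ 2 * ((1 / 5 + 3 / 10 * f) ^ 2 / 5) - (9 / 5) * (hs ^ 2 * (f ^ 2 / 16)) := by ring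
    rw [e2]
    rw [e3] at h1
    linarith [hYf]
  rw [hre, hs2re]
  linarith

/-- **Right descent of a corner-normalised anchor above the axis, in segment form, with margin `(0.007hs)²`.**  `p = z₀ + hs/5`, `q = x₀ + hs/2`;
for `0 ≤ Y₀ < hs/4`, `cc ≤ x₀ < cc + L + hs/4` and `t ∈ [0,1]`: `(0.007hs)² ≤ Re Σᵢ (Fᵢ z₀ − Fᵢ(p + t(q−p)))²`. [folklore] -/
theorem right_descent_re_ge {hs L cc : ℝ} {F : ℂ → (Fin 3 → ℂ)}
    (hF : DifferentiableOn ℂ F {z : ℂ | |z.im| < hs ∧ |z.re - cc| < L + hs})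
    (hM : ∀ z ∈ {z : ℂ | |z.im| < hs ∧ |z.re - cc| < L + hs}, ‖deriv F z‖ ≤ 2)
    (hunit : ∀ w ∈ {z : ℂ | |z.im| < hs ∧ |z.re - cc| < L + hs}, ∑ i, (deriv F w i) ^ 2 = 1)
    {X : ℝ → EuclideanSpace ℝ (Fin 3)} (hX : ContDiff ℝ 1 X) (hXu : ∀ τ, ‖deriv X τ‖ = 1)
    {Rb : ℝ} (hRb0 : 0 ≤ Rb) (hRb : Rb ≤ 1 / 2) (hosc : ∀ τ σ, ‖deriv X τ - deriv X σ‖ ≤ Rb)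
    (hFX : ∀ r : ℝ, (r : ℂ) ∈ {z : ℂ | |z.im| < hs ∧ |z.re - cc| < L + hs} →
      F r = fun i => ((⟪X r, EuclideanSpace.single i (1:ℝ)⟫_ℝ : ℝ) : ℂ))
    (hhs : 0 < hs) {x₀ Y₀ : ℝ} (hY0 : 0 ≤ Y₀) (hY : Y₀ < hs / 4) (hx₀ : x₀ < cc + L + hs / 4) (hx₀cc : cc ≤ x₀) :
    ∀ t ∈ Icc (0:ℝ) 1,
      (0.007 * hs) ^ 2 ≤ (∑ i, (F ((x₀ : ℂ) + (Y₀ : ℂ) * Complex.I) i -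
          F ((((x₀ + hs / 5 : ℝ) : ℂ) + (Y₀ : ℂ) * Complex.I) + (t : ℂ) *
            (((x₀ + hs / 2 : ℝ) : ℂ) - (((x₀ + hs / 5 : ℝ) : ℂ) + (Y₀ : ℂ) * Complex.I))) i) ^ 2).re := by
  intro t ht
  set z₀ : ℂ := (x₀ : ℂ) + (Y₀ : ℂ) * Complex.I with hz₀
  set ζ : ℂ := (((x₀ + hs / 5 : ℝ) : ℂ) + (Y₀ : ℂ) * Complex.I) + (t : ℂ) *
      (((x₀ + hs / 2 : ℝ) : ℂ) - (((x₀ + hs / 5 : ℝ) : ℂ) + (Y₀ : ℂ) * Complex.I)) with hζ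
  have eζ : ζ = (((x₀ + (hs / 5 + 3 * hs / 10 * t)) : ℝ) : ℂ) + ((Y₀ * (1 - t) : ℝ) : ℂ) * Complex.I := by
    rw [hζ]; push_cast; ring
  have hsq : ∀ w : ℂ, (∑ i, (F w i - F z₀ i) ^ 2) = ∑ i, (F z₀ i - F w i) ^ 2 :=
    fun w => Finset.sum_congr rfl fun i _ => by ring
  have hhs2 : 0 < hs ^ 2 := by positivity
  rcases le_or_gt t (2 / 5) with h1 | h1
  · have h := near_descent_re_ge hF hM hunit hhs (x₀ := x₀) (Y := Y₀) (f := t) hY0 hY hx₀ hx₀cc ht.1 h1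
    rw [← eζ, hsq] at h
    nlinarith
  rcases le_or_gt t (11 / 20) with h2 | h2
  · have h := corner_right_descent_mid_re_ge hF hM hunit hhs (x₀ := x₀) (Y := Y₀) (f := t) hY0 hY hx₀ hx₀cc h1.le h2
    rw [← eζ, hsq] at h
    nlinarith
  · have h := corner_right_descent_far_re_ge hF hM hunit hX hXu hRb0 hRb hosc hFX hhs (x₀ := x₀) (Y := Y₀) (f := t)
      hY0 hY hx₀ hx₀cc h2.le ht.2
    rw [← eζ, hsq] at h
    exact h

/-- **Right descent margin for a corner-normalised anchor of EITHER sign** (`|Y₀| < hs/4`; below the axis by conjugation symmetry of the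
continuation, `Theorems.StadiumCornerConj.chord_sq_conj`). [folklore] -/
theorem right_descent_re_ge_any {hs L cc : ℝ} {F : ℂ → (Fin 3 → ℂ)}
    (hF : DifferentiableOn ℂ F {z : ℂ | |z.im| < hs ∧ |z.re - cc| < L + hs})
    (hM : ∀ z ∈ {z : ℂ | |z.im| < hs ∧ |z.re - cc| < L + hs}, ‖deriv F z‖ ≤ 2)
    (hunit : ∀ w ∈ {z : ℂ | |z.im| < hs ∧ |z.re - cc| < L + hs}, ∑ i, (deriv F w i) ^ 2 = 1)
    {X : ℝ → EuclideanSpace ℝ (Fin 3)} (hX : ContDiff ℝ 1 X) (hXu : ∀ τ, ‖deriv X τ‖ = 1)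
    {Rb : ℝ} (hRb0 : 0 ≤ Rb) (hRb : Rb ≤ 1 / 2) (hosc : ∀ τ σ, ‖deriv X τ - deriv X σ‖ ≤ Rb)
    (hFX : ∀ r : ℝ, (r : ℂ) ∈ {z : ℂ | |z.im| < hs ∧ |z.re - cc| < L + hs} →
      F r = fun i => ((⟪X r, EuclideanSpace.single i (1:ℝ)⟫_ℝ : ℝ) : ℂ))
    (hhs : 0 < hs) {x₀ Y₀ : ℝ} (hY : |Y₀| < hs / 4) (hx₀ : x₀ < cc + L + hs / 4) (hx₀cc : cc ≤ x₀) :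
    ∀ t ∈ Icc (0:ℝ) 1,
      (0.007 * hs) ^ 2 ≤ (∑ i, (F ((x₀ : ℂ) + (Y₀ : ℂ) * Complex.I) i -
          F ((((x₀ + hs / 5 : ℝ) : ℂ) + (Y₀ : ℂ) * Complex.I) + (t : ℂ) *
            (((x₀ + hs / 2 : ℝ) : ℂ) - (((x₀ + hs / 5 : ℝ) : ℂ) + (Y₀ : ℂ) * Complex.I))) i) ^ 2).re := by
  have hY' := abs_lt.mp hY
  rcases le_or_gt 0 Y₀ with h | h
  · exact right_descent_re_ge hF hM hunit hX hXu hRb0 hRb hosc hFX hhs h hY'.2 hx₀ hx₀cc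
  intro t ht
  set S : Set ℂ := {z : ℂ | |z.im| < hs ∧ |z.re - cc| < L + hs} with hS
  have hLs : 0 < L + hs := by linarith [hx₀cc, hx₀]
  set Y' : ℝ := -Y₀ with hY'def
  have hY'0 : 0 ≤ Y' := by rw [hY'def]; linarith
  have hY'lt : Y' < hs / 4 := by rw [hY'def]; linarith
  have hup := right_descent_re_ge hF hM hunit hX hXu hRb0 hRb hosc hFX hhs hY'0 hY'lt hx₀ hx₀cc t ht
  set z₀ : ℂ := (x₀ : ℂ) + (Y₀ : ℂ) * Complex.I with hz₀
  set ζ : ℂ := (((x₀ + hs / 5 : ℝ) : ℂ) + (Y₀ : ℂ) * Complex.I) + (t : ℂ) *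
      (((x₀ + hs / 2 : ℝ) : ℂ) - (((x₀ + hs / 5 : ℝ) : ℂ) + (Y₀ : ℂ) * Complex.I)) with hζ
  have e : ζ = (((x₀ + (hs / 5 + 3 * hs / 10 * t)) : ℝ) : ℂ) + ((Y₀ * (1 - t) : ℝ) : ℂ) * Complex.I := by
    rw [hζ]; push_cast; ring
  have ez : (x₀ : ℂ) + (Y' : ℂ) * Complex.I = conj z₀ := by
    apply Complex.ext <;> simp [hz₀, hY'def]
  have eζ : (((x₀ + hs / 5 : ℝ) : ℂ) + (Y' : ℂ) * Complex.I) + (t : ℂ) *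
      (((x₀ + hs / 2 : ℝ) : ℂ) - (((x₀ + hs / 5 : ℝ) : ℂ) + (Y' : ℂ) * Complex.I)) = conj ζ := by
    have e' : (((x₀ + hs / 5 : ℝ) : ℂ) + (Y' : ℂ) * Complex.I) + (t : ℂ) *
        (((x₀ + hs / 2 : ℝ) : ℂ) - (((x₀ + hs / 5 : ℝ) : ℂ) + (Y' : ℂ) * Complex.I)) =
        (((x₀ + (hs / 5 + 3 * hs / 10 * t)) : ℝ) : ℂ) + ((Y' * (1 - t) : ℝ) : ℂ) * Complex.I := by
      push_cast; ring
    rw [e', e]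
    set A : ℝ := x₀ + (hs / 5 + 3 * hs / 10 * t) with hA
    set B : ℝ := Y₀ * (1 - t) with hB
    have hB' : Y' * (1 - t) = -B := by rw [hY'def, hB]; ring
    rw [hB']
    apply Complex.ext <;> simp
  rw [ez, eζ] at hup
  have hz₀S : z₀ ∈ S := by
    refine ⟨?_, ?_⟩
    · simp [hz₀]; rw [abs_lt]; constructor <;> linarith
    · simp [hz₀]; rw [abs_lt]; constructor <;> linarith
  have hζS : ζ ∈ S := by
    rw [e]
    refine ⟨?_, ?_⟩
    · simp
      rw [abs_of_nonneg (sub_nonneg.mpr ht.2)]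
      have : |Y₀| < hs / 4 := hY
      nlinarith [abs_nonneg Y₀, ht.1, ht.2]
    · simp; rw [abs_lt]; constructor <;> nlinarith [ht.1, ht.2]
  have hconj := (chord_sq_conj hF hFX hhs hLs hz₀S hζS).2
  have hsq : ∀ a b : ℂ, (∑ i, (F a i - F b i) ^ 2) = ∑ i, (F b i - F a i) ^ 2 :=
    fun a b => Finset.sum_congr rfl fun i _ => by ring
  rw [hsq (conj z₀) (conj ζ), hconj, ← hsq] at hup
  exact hup

/-- **Right descent margin for EVERY anchor of the quarter stadium** (`|Y₀| < hs/4`, `|x₀ − cc| < L + hs/4`; re-centred certificates). [folklore] -/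
theorem right_descent_re_ge_general {hs L cc : ℝ} {F : ℂ → (Fin 3 → ℂ)}
    (hF : DifferentiableOn ℂ F {z : ℂ | |z.im| < hs ∧ |z.re - cc| < L + hs})
    (hM : ∀ z ∈ {z : ℂ | |z.im| < hs ∧ |z.re - cc| < L + hs}, ‖deriv F z‖ ≤ 2)
    (hunit : ∀ w ∈ {z : ℂ | |z.im| < hs ∧ |z.re - cc| < L + hs}, ∑ i, (deriv F w i) ^ 2 = 1)
    {X : ℝ → EuclideanSpace ℝ (Fin 3)} (hX : ContDiff ℝ 1 X) (hXu : ∀ τ, ‖deriv X τ‖ = 1)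
    {Rb : ℝ} (hRb0 : 0 ≤ Rb) (hRb : Rb ≤ 1 / 2) (hosc : ∀ τ σ, ‖deriv X τ - deriv X σ‖ ≤ Rb)
    (hFX : ∀ r : ℝ, (r : ℂ) ∈ {z : ℂ | |z.im| < hs ∧ |z.re - cc| < L + hs} →
      F r = fun i => ((⟪X r, EuclideanSpace.single i (1:ℝ)⟫_ℝ : ℝ) : ℂ))
    (hhs : 0 < hs) {x₀ Y₀ : ℝ} (hY : |Y₀| < hs / 4) (hx₀ : |x₀ - cc| < L + hs / 4) :
    ∀ t ∈ Icc (0:ℝ) 1,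
      (0.007 * hs) ^ 2 ≤ (∑ i, (F ((x₀ : ℂ) + (Y₀ : ℂ) * Complex.I) i -
          F ((((x₀ + hs / 5 : ℝ) : ℂ) + (Y₀ : ℂ) * Complex.I) + (t : ℂ) *
            (((x₀ + hs / 2 : ℝ) : ℂ) - (((x₀ + hs / 5 : ℝ) : ℂ) + (Y₀ : ℂ) * Complex.I))) i) ^ 2).re := by
  obtain ⟨hlo, hhi, hcc, hlt⟩ := centre_at_target (hs := hs) (L := L) (cc := cc) hx₀
  obtain ⟨hF', hM', hunit', hFX'⟩ := restrict_package hF hM hunit hFX hlo hhi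
  exact right_descent_re_ge_any hF' hM' hunit' hX hXu hRb0 hRb hosc hFX' hhs hY hlt hcc

/-- **Left ascent margin for every anchor of the quarter stadium, tent orientation** (`p = x₀ − hs/2 → q = (x₀ − hs/5) + iY₀`): for `t ∈ [0,1]`,
`(0.007hs)² ≤ Re Σᵢ (Fᵢ z₀ − Fᵢ(p + t(q − p)))²` — the right descent of the point-reflected data at parameter `1 − t`. [folklore] -/
theorem left_ascent_re_ge_general {hs L cc : ℝ} {F : ℂ → (Fin 3 → ℂ)}
    (hF : DifferentiableOn ℂ F {z : ℂ | |z.im| < hs ∧ |z.re - cc| < L + hs})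
    (hM : ∀ z ∈ {z : ℂ | |z.im| < hs ∧ |z.re - cc| < L + hs}, ‖deriv F z‖ ≤ 2)
    (hunit : ∀ w ∈ {z : ℂ | |z.im| < hs ∧ |z.re - cc| < L + hs}, ∑ i, (deriv F w i) ^ 2 = 1)
    {X : ℝ → EuclideanSpace ℝ (Fin 3)} (hX : ContDiff ℝ 1 X) (hXu : ∀ τ, ‖deriv X τ‖ = 1)
    {Rb : ℝ} (hRb0 : 0 ≤ Rb) (hRb : Rb ≤ 1 / 2) (hosc : ∀ τ σ, ‖deriv X τ - deriv X σ‖ ≤ Rb)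
    (hFX : ∀ r : ℝ, (r : ℂ) ∈ {z : ℂ | |z.im| < hs ∧ |z.re - cc| < L + hs} →
      F r = fun i => ((⟪X r, EuclideanSpace.single i (1:ℝ)⟫_ℝ : ℝ) : ℂ))
    (hhs : 0 < hs) {x₀ Y₀ : ℝ} (hY : |Y₀| < hs / 4) (hx₀ : |x₀ - cc| < L + hs / 4) :
    ∀ t ∈ Icc (0:ℝ) 1,
      (0.007 * hs) ^ 2 ≤ (∑ i, (F ((x₀ : ℂ) + (Y₀ : ℂ) * Complex.I) i -
          F (((x₀ - hs / 2 : ℝ) : ℂ) + (t : ℂ) *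
            ((((x₀ - hs / 5 : ℝ) : ℂ) + (Y₀ : ℂ) * Complex.I) - ((x₀ - hs / 2 : ℝ) : ℂ))) i) ^ 2).re := by
  intro t ht
  obtain ⟨hF', hM', hunit', hX', hXu', hosc', hFX'⟩ := reflect_package (x := x₀) hF hM hunit hX hXu hosc hFX
  have hx₀' : |x₀ - (2 * x₀ - cc)| < L + hs / 4 := by
    rw [show x₀ - (2 * x₀ - cc) = -(x₀ - cc) by ring, abs_neg]; exact hx₀
  have hY' : |(-Y₀)| < hs / 4 := by rw [abs_neg]; exact hY
  have ht' : (1 - t) ∈ Icc (0:ℝ) 1 := ⟨by linarith [ht.2], by linarith [ht.1]⟩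
  have key := right_descent_re_ge_general hF' hM' hunit' hX' hXu' hRb0 hRb hosc' hFX' hhs hY' hx₀' (1 - t) ht'
  have e0 : 2 * (x₀ : ℂ) - ((x₀ : ℂ) + ((-Y₀ : ℝ) : ℂ) * Complex.I) = (x₀ : ℂ) + (Y₀ : ℂ) * Complex.I := by
    push_cast; ring
  have e1 : 2 * (x₀ : ℂ) - ((((x₀ + hs / 5 : ℝ) : ℂ) + ((-Y₀ : ℝ) : ℂ) * Complex.I) + ((1 - t : ℝ) : ℂ) *
      (((x₀ + hs / 2 : ℝ) : ℂ) - (((x₀ + hs / 5 : ℝ) : ℂ) + ((-Y₀ : ℝ) : ℂ) * Complex.I))) =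
      ((x₀ - hs / 2 : ℝ) : ℂ) + (t : ℂ) * ((((x₀ - hs / 5 : ℝ) : ℂ) + (Y₀ : ℂ) * Complex.I) - ((x₀ - hs / 2 : ℝ) : ℂ)) := by
    push_cast; ring
  rw [e0, e1] at key
  exact key

end Summit.NavierStokesRegularity.NavierStokesRegularity.Theorems.StadiumQuarterDescentMargin

end
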